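import Literature.MathematicalPhysics.QuantumFieldTheory.Federbush1986.LatticeActionLimit

/-!
# `Federbush1986.AbelianEstimatesLe` — [Federbush1986PhaseCellI] §0 pp. 320–321, Estimates 0.1–0.7 and the statement of §0
# READ WITH `≤` (`Estimate01Le`–`Estimate07Le`, `ModeEstimatesLe`); the typed strict package `AbelianAveraging.ModeEstimates`
# REFUTED AS TYPED (strict `<` at degenerate data) — a typing defect, nothing in print fails

statement-level skeleton of published theorems with citation tags; proofs where landed; nothing here is a claim about the Yang–Mills mass gap

CITATION HEADER.  P. Federbush, *A phase cell approach to Yang–Mills theory. I. Modes, lattice-continuum duality*, Commun.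
Math. Phys. **107** (1986) 319–329 [Federbush1986PhaseCellI] (journal page = PDF page + 318; renders
`run/shared/lean/pub/lit-balaban/lit-balaban-r17/renders/fedI/fed1986-cmp107-p0NN-x2.png` re-read AS IMAGES by this seat):
§0 pp. 320–321 Estimates 0.1–0.7 (0.2)–(0.11) and the sentence *«We will find an A_μ(x) compatible with this assignment,
minimizing the continuum action, and "smooth" enough, so that the following results hold for the induced assignments to the
finer lattices, and for A_μ(x).»*; §3 (3.1) p. 327; (3.13)–(3.14) p. 328.  Unit `lit-balaban-p04` gen 6; SKELETON rows
**F1.Eq3.1**, F1.Eq0.2 … F1.Eq0.10-0.11 (typed p239224 in `AbelianModeEstimates.lean`: `AbelianAveraging.ModeEstimates`,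
`Estimate01`–`Estimate07`) of `run/shared/lean/pub/lit-balaban/lit-balaban-r17/SKELETON-r17.md` (fold owner r17); companion
module `AbelianEstimatesSect4` (the §4 «easy implications» proved for the predicates below).

THE MATHEMATICS.  (A) THE TYPED PACKAGE IS REFUTABLE AS TYPED.  The typed Estimates keep print's strict `<`.  For the ZERO
data `a = 0` at level `r₀` (admissible in `ModeEstimates`: it vanishes outside every ball about `z`) one has
`|A(m)| = maxAssign 0 = 0`, so the strict Estimate 0.1 demands `|A_μ(x)| < 0` of the minimiser — impossible for every field,
every carrier `D` and all constants: **`not_modeEstimates : ¬ D.ModeEstimates`**.  Independently, the strict Estimate 0.5 at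
`e₁ = e₂` and the strict Estimate 0.7 at `p₁ = p₂` demand `0 < 0` as soon as the region (0.8)/(0.11) is non-empty
(`not_estimate05_self`, `not_estimate07_self`).  The companion typings (2.13)/(2.15) of the same file were typed with `≤` for
exactly this reason («strictness as printed fails for A ≡ 0; READING»).  (B) THE `≤` RE-TYPING: same signatures and
constants, `<` ↦ `≤`; in (0.7)–(0.8) print's generic letter `c` occurs twice (bound (0.7), region (0.8)) and is separated
into `c` and `c₁` (`Estimate05Le r₀ c₁ c …`; `ModeEstimatesLe` takes `c₁ = c`, the typed shape).  Each `≤` predicate is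
implied by its strict counterpart (`Estimate01.le`, …, `ModeEstimates.le`), the amplitudes `cL⁻¹|A(m)|`, `cL⁻²|A(m)|` are
effectively non-negative (`coeff_nonneg`) and give the bounds (2.3)–(2.4) (`bound`); (3.13)/(3.14) are Estimates 0.1/0.2 of
the level-0 configuration (`L = 1`, `z = 0`, `|A(m)| = 1`).  These are STATEMENTS (8 `Prop` definitions with print's
citation); no claim that `ModeEstimatesLe` holds is made here (its printed proof rests on Part II's Theorem 3.1, cf.
`ModeAnalyticityThm31Refutation`).

WHAT THIS MODULE PROVIDES.  §1 `maxAssign_zero`, `not_estimate01_zero`, `not_estimate05_self`, `not_estimate07_self`,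
**`not_modeEstimates`**; §2 `Estimate01Le`–`Estimate07Le`, `ModeEstimatesLe` + `.le` knitting; §3 `coeff_nonneg`, `bound`,
`estimate01Le_of_decay313`, `estimate02Le_of_decay314`; §4 geometry for the companion module (`latLen_le_of_le`,
`dist_src_shift` — adjacent parallel edges are at distance `ℓ_s`, `dist_samplePt_le` — the sample points of the plaquette
average (1.14) lie within `4ℓ` of the corner, `exp_weight_le`, `plaqAvg_comp_add`, `plaqOfBonds_eq_sub_sub`).  Imports r17's
`LatticeActionLimit` (for `plaqAvg`) and `PlaquetteStokes` (`Edge.src_shift`).  No new unproved fact; axioms standard.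
-/

namespace Literature.MathematicalPhysics.QuantumFieldTheory.Federbush1986

open MeasureTheory Filter Set
open scoped BigOperators Topology

namespace AbelianAveraging

variable (D : AbelianAveraging)

/-! ## §1 The typed strict package fails at degenerate data -/

/-- `|A(m)| = 0` for the zero data: «|A(m)| … the largest assignment, in absolute value, at the length scale L».
[cite: Federbush1986PhaseCellI, §0 p. 320] -/
theorem maxAssign_zero (r₀ : ℕ) : maxAssign (0 : Edge r₀ → ℝ) = 0 := by
  simp [maxAssign]

/-- Estimate 0.1 AS TYPED (strict (0.2)) is unsatisfiable when `|A(m)| = 0`: it demands `|A_μ(x)| < 0`.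
[cite: Federbush1986PhaseCellI, Estimate 0.1 (0.2) p. 320] -/
theorem not_estimate01_zero (c γ L : ℝ) (z : E4) (A : E4 → Fin 4 → ℝ) : ¬ Estimate01 c γ L z 0 A := by
  intro h
  have h' := h z 0
  rw [mul_zero] at h'
  linarith [abs_nonneg (A z 0)]

/-- Estimate 0.5 AS TYPED (strict (0.7)) is unsatisfiable at `e₁ = e₂` as soon as the region (0.8) `d(e₁,e₂) < cL` is
non-empty (`0 < cL`): it demands `0 < 0`. [cite: Federbush1986PhaseCellI, Estimate 0.5 (0.7)–(0.8) p. 320] -/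
theorem not_estimate05_self {c L : ℝ} (hcL : 0 < c * L) (r₀ : ℕ) (γ : ℝ) (z : E4) (Am : ℝ) (A : E4 → Fin 4 → ℝ) :
    ¬ D.Estimate05 r₀ c γ L z Am A := by
  intro h
  have h' := h r₀ le_rfl ⟨0, 0⟩ ⟨0, 0⟩ rfl (by rwa [dist_self])
  simp at h'

/-- Estimate 0.7 AS TYPED (strict (0.10)) is unsatisfiable at `p₁ = p₂` (take `ε = 1/2`) as soon as the region (0.11) is
non-empty: it demands `0 < 0`. [cite: Federbush1986PhaseCellI, Estimate 0.7 (0.10)–(0.11) p. 321] -/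
theorem not_estimate07_self {c L : ℝ} (hcL : 0 < c * L) (r₀ : ℕ) (γ : ℝ) (cε : ℝ → ℝ) (z : E4) (Am : ℝ)
    (A : E4 → Fin 4 → ℝ) : ¬ D.Estimate07 r₀ c γ L cε z Am A := by
  intro h
  have h' := h (1 / 2) (by norm_num) r₀ le_rfl ⟨0, 0, 1⟩ ⟨0, 0, 1⟩ rfl rfl (by rwa [dist_self])
  rw [dist_self, Real.zero_rpow (by norm_num), sub_self, abs_zero] at h'
  simp at h'

/-- **The §0 package AS TYPED is refutable for every carrier**: `ModeEstimates` admits the zero data `a = 0` (it vanishes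
outside every ball about `z`), for which `|A(m)| = 0` and the strict Estimate 0.1 demands `|A_μ(x)| < 0` of the minimiser.
A typing defect (print's `<` kept at degenerate data), not a claim about print; the `≤` reading is `ModeEstimatesLe` below.
[cite: Federbush1986PhaseCellI, §0 pp. 320–321; §3 (3.1) p. 327] -/
theorem not_modeEstimates : ¬ D.ModeEstimates := by
  intro h
  obtain ⟨c, -, γ, -, cε, H⟩ := h 1 one_pos
  obtain ⟨A, -, h01, -⟩ := H 0 0 (0 : Edge 0 → ℝ) (fun _ _ => rfl)
  rw [maxAssign_zero] at h01
  exact not_estimate01_zero _ _ _ _ _ h01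

/-! ## §2 The `≤` re-typing of Estimates 0.1–0.7 and of the statement of §0 -/

/-- **Estimate 0.1, `≤` reading.** «|A_μ(x)| < c (1/L) e^{−γ|x−z|/L} |A(m)|. (0.2)» [cite: Federbush1986PhaseCellI,
Estimate 0.1 (0.2) p. 320] -/
def Estimate01Le (c γ L : ℝ) (z : E4) (Am : ℝ) (A : E4 → Fin 4 → ℝ) : Prop :=
  ∀ x μ, |A x μ| ≤ c * (1 / L) * Real.exp (-γ * dist x z / L) * Am

/-- **Estimate 0.2, `≤` reading.** «|DA_μ(x)| < (c/L²) e^{−γ|x−z|/L} |A(m)|, (0.3) where D indicates any first partial.»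
[cite: Federbush1986PhaseCellI, Estimate 0.2 (0.3) p. 320] -/
def Estimate02Le (c γ L : ℝ) (z : E4) (Am : ℝ) (A : E4 → Fin 4 → ℝ) : Prop :=
  ∀ x ν μ, |pd A ν μ x| ≤ c / L ^ 2 * Real.exp (-γ * dist x z / L) * Am

/-- **Estimate 0.3, `≤` reading.** «(1/|x−y|^{1−ε}) |DA_μ(x) − DA_μ(y)| < (c_ε/L^{3−ε}) e^{−γ|x−z|/L} |A(m)| each ε > 0, (0.4)
where |x − y| < cL. (0.5)» [cite: Federbush1986PhaseCellI, Estimate 0.3 (0.4)–(0.5) p. 320] -/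
def Estimate03Le (c γ L : ℝ) (cε : ℝ → ℝ) (z : E4) (Am : ℝ) (A : E4 → Fin 4 → ℝ) : Prop :=
  ∀ ε > (0 : ℝ), ∀ x y ν μ, x ≠ y → dist x y < c * L →
    |pd A ν μ x - pd A ν μ y| / dist x y ^ (1 - ε) ≤ cε ε / L ^ (3 - ε) * Real.exp (-γ * dist x z / L) * Am

/-- **Estimate 0.4, `≤` reading.** «|A(e)| < c (l/L) e^{−γd(e,z)/L} |A(m)|. (0.6)» for the induced assignments at the levels
`s ≥ r₀`. [cite: Federbush1986PhaseCellI, Estimate 0.4 (0.6) p. 320] -/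
def Estimate04Le (r₀ : ℕ) (c γ L : ℝ) (z : E4) (Am : ℝ) (A : E4 → Fin 4 → ℝ) : Prop :=
  ∀ s, r₀ ≤ s → ∀ e : Edge s, |D.bond s A e| ≤ c * (latLen s / L) * Real.exp (-γ * dist e.src z / L) * Am

/-- **Estimate 0.5, `≤` reading, with the two occurrences of the generic constant separated** (`c₁`: region (0.8), `c`:
bound (0.7)): «Let e₁ and e₂ be parallel (oriented) edges at length scale l, |A(e₁) − A(e₂)| < c (l/L)·(d(e₁,e₂)/L)
e^{−γd(e₁,z)/L} |A(m)|, (0.7) where d(e₁, e₂) < cL. (0.8)». [cite: Federbush1986PhaseCellI, Estimate 0.5 (0.7)–(0.8) p. 320] -/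
def Estimate05Le (r₀ : ℕ) (c₁ c γ L : ℝ) (z : E4) (Am : ℝ) (A : E4 → Fin 4 → ℝ) : Prop :=
  ∀ s, r₀ ≤ s → ∀ e₁ e₂ : Edge s, e₁.dir = e₂.dir → dist e₁.src e₂.src < c₁ * L →
    |D.bond s A e₁ - D.bond s A e₂|
      ≤ c * (latLen s / L) * (dist e₁.src e₂.src / L) * Real.exp (-γ * dist e₁.src z / L) * Am

/-- **Estimate 0.6, `≤` reading.** «|A_{∂p}| < c (l/L)² e^{−γd(p,z)/L} |A(m)|. (0.9)» [cite: Federbush1986PhaseCellI,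
Estimate 0.6 (0.9) p. 320] -/
def Estimate06Le (r₀ : ℕ) (c γ L : ℝ) (z : E4) (Am : ℝ) (A : E4 → Fin 4 → ℝ) : Prop :=
  ∀ s, r₀ ≤ s → ∀ p : Plaq s, |D.plaq s A p| ≤ c * (latLen s / L) ^ 2 * Real.exp (-γ * dist p.src z / L) * Am

/-- **Estimate 0.7, `≤` reading.** «|A_{∂p₁} − A_{∂p₂}| < c_ε (d(p₁,p₂))^{1−ε} (l²/L^{3−ε}) e^{−γd(p₁,z)/L} |A(m)| each ε > 0,
(0.10) where … d(p₁, p₂) < cL. (0.11)» [cite: Federbush1986PhaseCellI, Estimate 0.7 (0.10)–(0.11) p. 321] -/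
def Estimate07Le (r₀ : ℕ) (c γ L : ℝ) (cε : ℝ → ℝ) (z : E4) (Am : ℝ) (A : E4 → Fin 4 → ℝ) : Prop :=
  ∀ ε > (0 : ℝ), ∀ s, r₀ ≤ s → ∀ p₁ p₂ : Plaq s, p₁.dir₁ = p₂.dir₁ → p₁.dir₂ = p₂.dir₂ →
    dist p₁.src p₂.src < c * L →
      |D.plaq s A p₁ - D.plaq s A p₂|
        ≤ cε ε * dist p₁.src p₂.src ^ (1 - ε) * (latLen s ^ 2 / L ^ (3 - ε))
            * Real.exp (-γ * dist p₁.src z / L) * Am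

/-- **The statement of §0, `≤` reading** (same quantifier structure as the typed `ModeEstimates`): «We will find an A_μ(x)
compatible with this assignment, minimizing the continuum action, and "smooth" enough, so that the following results hold for
the induced assignments to the finer lattices, and for A_μ(x)» — Estimates 0.1–0.7 read with `≤`.
[cite: Federbush1986PhaseCellI, §0 pp. 320–321; §3 p. 327; §4 pp. 328–329] -/
def ModeEstimatesLe : Prop :=
  ∀ c₀ > (0 : ℝ), ∃ c > (0 : ℝ), ∃ γ > (0 : ℝ), ∃ cε : ℝ → ℝ,
    ∀ (r₀ : ℕ) (z : E4) (a : Edge r₀ → ℝ),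
      (∀ e : Edge r₀, c₀ * latLen r₀ < dist e.src z → a e = 0) →
        ∃ A : E4 → Fin 4 → ℝ, D.IsConstrainedMinimizer r₀ a A ∧
          Estimate01Le c γ (latLen r₀) z (maxAssign a) A ∧ Estimate02Le c γ (latLen r₀) z (maxAssign a) A ∧
          Estimate03Le c γ (latLen r₀) cε z (maxAssign a) A ∧ D.Estimate04Le r₀ c γ (latLen r₀) z (maxAssign a) A ∧
          D.Estimate05Le r₀ c c γ (latLen r₀) z (maxAssign a) A ∧ D.Estimate06Le r₀ c γ (latLen r₀) z (maxAssign a) A ∧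
          D.Estimate07Le r₀ c γ (latLen r₀) cε z (maxAssign a) A

variable {D}

/-- The typed (strict) Estimate 0.1 implies its `≤` reading. [cite: Federbush1986PhaseCellI, Estimate 0.1 (0.2) p. 320] -/
theorem Estimate01.le {c γ L : ℝ} {z : E4} {Am : ℝ} {A : E4 → Fin 4 → ℝ} (h : Estimate01 c γ L z Am A) :
    Estimate01Le c γ L z Am A := fun x μ => (h x μ).le

/-- The typed (strict) Estimate 0.2 implies its `≤` reading. [cite: Federbush1986PhaseCellI, Estimate 0.2 (0.3) p. 320] -/
theorem Estimate02.le {c γ L : ℝ} {z : E4} {Am : ℝ} {A : E4 → Fin 4 → ℝ} (h : Estimate02 c γ L z Am A) :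
    Estimate02Le c γ L z Am A := fun x ν μ => (h x ν μ).le

/-- The typed (strict) Estimate 0.3 implies its `≤` reading. [cite: Federbush1986PhaseCellI, Estimate 0.3 (0.4) p. 320] -/
theorem Estimate03.le {c γ L : ℝ} {cε : ℝ → ℝ} {z : E4} {Am : ℝ} {A : E4 → Fin 4 → ℝ}
    (h : Estimate03 c γ L cε z Am A) : Estimate03Le c γ L cε z Am A :=
  fun ε hε x y ν μ hxy hd => (h ε hε x y ν μ hxy hd).le

/-- The typed (strict) Estimate 0.4 implies its `≤` reading. [cite: Federbush1986PhaseCellI, Estimate 0.4 (0.6) p. 320] -/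
theorem Estimate04.le {r₀ : ℕ} {c γ L : ℝ} {z : E4} {Am : ℝ} {A : E4 → Fin 4 → ℝ}
    (h : D.Estimate04 r₀ c γ L z Am A) : D.Estimate04Le r₀ c γ L z Am A := fun s hs e => (h s hs e).le

/-- The typed (strict) Estimate 0.5 implies its `≤` reading (with `c₁ = c`). [cite: Federbush1986PhaseCellI, Estimate 0.5
(0.7)–(0.8) p. 320] -/
theorem Estimate05.le {r₀ : ℕ} {c γ L : ℝ} {z : E4} {Am : ℝ} {A : E4 → Fin 4 → ℝ}
    (h : D.Estimate05 r₀ c γ L z Am A) : D.Estimate05Le r₀ c c γ L z Am A :=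
  fun s hs e₁ e₂ hdir hd => (h s hs e₁ e₂ hdir hd).le

/-- The typed (strict) Estimate 0.6 implies its `≤` reading. [cite: Federbush1986PhaseCellI, Estimate 0.6 (0.9) p. 320] -/
theorem Estimate06.le {r₀ : ℕ} {c γ L : ℝ} {z : E4} {Am : ℝ} {A : E4 → Fin 4 → ℝ}
    (h : D.Estimate06 r₀ c γ L z Am A) : D.Estimate06Le r₀ c γ L z Am A := fun s hs p => (h s hs p).le

/-- The typed (strict) Estimate 0.7 implies its `≤` reading. [cite: Federbush1986PhaseCellI, Estimate 0.7 (0.10) p. 321] -/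
theorem Estimate07.le {r₀ : ℕ} {c γ L : ℝ} {cε : ℝ → ℝ} {z : E4} {Am : ℝ} {A : E4 → Fin 4 → ℝ}
    (h : D.Estimate07 r₀ c γ L cε z Am A) : D.Estimate07Le r₀ c γ L cε z Am A :=
  fun ε hε s hs p₁ p₂ h₁ h₂ hd => (h ε hε s hs p₁ p₂ h₁ h₂ hd).le

/-- The typed §0 package implies its `≤` reading (formal knitting; the antecedent is refuted by `not_modeEstimates`).
[cite: Federbush1986PhaseCellI, §0 pp. 320–321] -/
theorem ModeEstimates.le (h : D.ModeEstimates) : D.ModeEstimatesLe := by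
  intro c₀ hc₀
  obtain ⟨c, hc, γ, hγ, cε, H⟩ := h c₀ hc₀
  refine ⟨c, hc, γ, hγ, cε, fun r₀ z a ha => ?_⟩
  obtain ⟨A, hA, h1, h2, h3, h4, h5, h6, h7⟩ := H r₀ z a ha
  exact ⟨A, hA, h1.le, h2.le, h3.le, h4.le, h5.le, h6.le, h7.le⟩

/-! ## §3 Signs, the bounds (2.3)–(2.4), and (3.13)–(3.14) as the level-0 Estimates 0.1–0.2 -/

/-- The amplitude of a `≤`-Estimate 0.1 is effectively non-negative: `0 ≤ c L⁻¹ |A(m)|` (evaluate at `x = z`).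
[cite: Federbush1986PhaseCellI, Estimate 0.1 (0.2) p. 320] -/
theorem Estimate01Le.coeff_nonneg {c γ L : ℝ} {z : E4} {Am : ℝ} {A : E4 → Fin 4 → ℝ}
    (h : Estimate01Le c γ L z Am A) : 0 ≤ c * (1 / L) * Am := by
  have h' := h z 0
  rw [dist_self, mul_zero, zero_div, Real.exp_zero, mul_one] at h'
  exact (abs_nonneg _).trans h'

/-- The amplitude of a `≤`-Estimate 0.2 is effectively non-negative: `0 ≤ c L⁻² |A(m)|`.
[cite: Federbush1986PhaseCellI, Estimate 0.2 (0.3) p. 320] -/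
theorem Estimate02Le.coeff_nonneg {c γ L : ℝ} {z : E4} {Am : ℝ} {A : E4 → Fin 4 → ℝ}
    (h : Estimate02Le c γ L z Am A) : 0 ≤ c / L ^ 2 * Am := by
  have h' := h z 0 0
  rw [dist_self, mul_zero, zero_div, Real.exp_zero, mul_one] at h'
  exact (abs_nonneg _).trans h'

/-- Under a `≤`-Estimate 0.1 with `γ ≥ 0`, `L > 0` the field is bounded: (2.3) with `B₁ = cL⁻¹|A(m)|`.
[cite: Federbush1986PhaseCellI, (2.3) p. 325, Estimate 0.1 p. 320] -/
theorem Estimate01Le.bound {c γ L : ℝ} {z : E4} {Am : ℝ} {A : E4 → Fin 4 → ℝ} (h : Estimate01Le c γ L z Am A)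
    (hγ : 0 ≤ γ) (hL : 0 < L) : ∀ x μ, |A x μ| ≤ c * (1 / L) * Am := by
  intro x μ
  have hexp : Real.exp (-γ * dist x z / L) ≤ 1 := by
    rw [Real.exp_le_one_iff, neg_mul, neg_div, neg_nonpos]
    exact div_nonneg (mul_nonneg hγ dist_nonneg) hL.le
  calc |A x μ| ≤ c * (1 / L) * Real.exp (-γ * dist x z / L) * Am := h x μ
    _ = c * (1 / L) * Am * Real.exp (-γ * dist x z / L) := by ring
    _ ≤ c * (1 / L) * Am * 1 := by gcongr; exact h.coeff_nonneg
    _ = c * (1 / L) * Am := mul_one _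

/-- Under a `≤`-Estimate 0.2 with `γ ≥ 0`, `L > 0` the first partials are bounded: (2.4) with `B₂ = cL⁻²|A(m)|`.
[cite: Federbush1986PhaseCellI, (2.4) p. 325, Estimate 0.2 p. 320] -/
theorem Estimate02Le.bound {c γ L : ℝ} {z : E4} {Am : ℝ} {A : E4 → Fin 4 → ℝ} (h : Estimate02Le c γ L z Am A)
    (hγ : 0 ≤ γ) (hL : 0 < L) : ∀ x ν μ, |pd A ν μ x| ≤ c / L ^ 2 * Am := by
  intro x ν μ
  have hexp : Real.exp (-γ * dist x z / L) ≤ 1 := by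
    rw [Real.exp_le_one_iff, neg_mul, neg_div, neg_nonpos]
    exact div_nonneg (mul_nonneg hγ dist_nonneg) hL.le
  calc |pd A ν μ x| ≤ c / L ^ 2 * Real.exp (-γ * dist x z / L) * Am := h x ν μ
    _ = c / L ^ 2 * Am * Real.exp (-γ * dist x z / L) := by ring
    _ ≤ c / L ^ 2 * Am * 1 := by gcongr; exact h.coeff_nonneg
    _ = c / L ^ 2 * Am := mul_one _

/-- (3.13) is Estimate 0.1 (`≤` reading) of the level-0 configuration: `L = ℓ_0 = 1`, `z = 0`, `|A(m)| = 1`.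
[cite: Federbush1986PhaseCellI, (3.13) p. 328; §3 p. 327] -/
theorem estimate01Le_of_decay313 {AN : E4 → Fin 4 → ℝ} {c γ : ℝ} (h : ∀ x μ, |AN x μ| < c * Real.exp (-γ * ‖x‖)) :
    Estimate01Le c γ 1 0 1 AN := by
  intro x μ
  have h' := (h x μ).le
  simpa [dist_zero_right] using h'

/-- (3.14) is Estimate 0.2 (`≤` reading) of the level-0 configuration: `L = 1`, `z = 0`, `|A(m)| = 1`.
[cite: Federbush1986PhaseCellI, (3.14) p. 328; §3 p. 327] -/
theorem estimate02Le_of_decay314 {AN : E4 → Fin 4 → ℝ} {c γ : ℝ}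
    (h : ∀ x ν μ, |pd AN ν μ x| < c * Real.exp (-γ * ‖x‖)) : Estimate02Le c γ 1 0 1 AN := by
  intro x ν μ
  have h' := (h x ν μ).le
  simpa [dist_zero_right] using h'

/-! ## §4 Geometry of edges, plaquettes, sample points and weights (used by `AbelianEstimatesSect4`) -/

/-- `ℓ_s ≤ ℓ_{r₀}` for `s ≥ r₀`. [cite: Federbush1986PhaseCellI, §1 p. 321] -/
theorem latLen_le_of_le {r₀ s : ℕ} (h : r₀ ≤ s) : latLen s ≤ latLen r₀ := by
  rcases h.eq_or_lt with h | h
  · rw [h]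
  · exact (latLen_lt_of_lt h).le

/-- `‖u_μ‖ = 1`. [folklore] -/
private theorem norm_unitVec₅ (μ : Fin 4) : ‖(unitVec μ : E4)‖ = 1 := by
  unfold unitVec; simp

/-- `‖mkPt u‖ ≤ 2` for `u ∈ [0,1]⁴`. [folklore] -/
private theorem norm_mkPt_le_two₅ {u : Fin 4 → ℝ} (hu : u ∈ Icc (0 : Fin 4 → ℝ) 1) : ‖(mkPt u : E4)‖ ≤ 2 := by
  have hi : ∀ i, ‖(mkPt u : E4) i‖ ^ 2 ≤ 1 := by
    intro i
    have h0 : 0 ≤ u i := hu.1 i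
    have h1 : u i ≤ 1 := hu.2 i
    simp only [mkPt, PiLp.toLp_apply, Real.norm_eq_abs, sq_abs]
    nlinarith
  rw [EuclideanSpace.norm_eq]
  calc Real.sqrt (∑ i, ‖(mkPt u : E4) i‖ ^ 2) ≤ Real.sqrt (∑ _i : Fin 4, (1 : ℝ)) :=
        Real.sqrt_le_sqrt (Finset.sum_le_sum fun i _ => hi i)
    _ = 2 := by
        rw [Finset.sum_const, Finset.card_univ, Fintype.card_fin, nsmul_eq_mul, mul_one,
          show ((4 : ℕ) : ℝ) = 2 ^ 2 by norm_num, Real.sqrt_sq (by norm_num)]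

/-- Adjacent parallel edges `(b, d)` and `(b + 1_μ, d)` of `ℒ^s` are at distance `ℓ_s` «measured between corresponding
vertices». [cite: Federbush1986PhaseCellI, Estimate 0.5 p. 320; §2 p. 325] -/
theorem dist_src_shift {s : ℕ} (b : Fin 4 → ℤ) (μ d : Fin 4) :
    dist (⟨b, d⟩ : Edge s).src (⟨b + Pi.single μ 1, d⟩ : Edge s).src = latLen s := by
  rw [Edge.src_shift, dist_self_add_right, norm_smul, norm_unitVec₅, mul_one, Real.norm_of_nonneg (latLen_pos s).le]

/-- The sample points `x + ℓu + σu_μ + τu_ν` (`u ∈ [0,1]⁴`, `σ, τ ∈ [0,ℓ]`) of the plaquette average (1.14) lie within `4ℓ` of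
the corner `x`. [cite: Federbush1986PhaseCellI, (1.13)–(1.14) p. 324] -/
theorem dist_samplePt_le {ℓ : ℝ} (hℓ : 0 ≤ ℓ) (x : E4) {u : Fin 4 → ℝ} (hu : u ∈ Icc (0 : Fin 4 → ℝ) 1) {σ τ : ℝ}
    (hσ : σ ∈ Icc (0 : ℝ) ℓ) (hτ : τ ∈ Icc (0 : ℝ) ℓ) (μ ν : Fin 4) :
    dist (x + ℓ • mkPt u + σ • unitVec μ + τ • unitVec ν) x ≤ 4 * ℓ := by
  rw [dist_eq_norm, show x + ℓ • mkPt u + σ • unitVec μ + τ • unitVec ν - x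
      = ℓ • mkPt u + σ • unitVec μ + τ • unitVec ν by abel]
  calc ‖ℓ • mkPt u + σ • unitVec μ + τ • unitVec ν‖
      ≤ ‖ℓ • (mkPt u : E4)‖ + ‖σ • (unitVec μ : E4)‖ + ‖τ • (unitVec ν : E4)‖ := norm_add₃_le
    _ ≤ ℓ * 2 + σ + τ := by
        rw [norm_smul, norm_smul, norm_smul, norm_unitVec₅, norm_unitVec₅, mul_one, mul_one,
          Real.norm_of_nonneg hℓ, Real.norm_of_nonneg hσ.1, Real.norm_of_nonneg hτ.1]
        gcongr
        exact norm_mkPt_le_two₅ hu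
    _ ≤ 4 * ℓ := by linarith [hσ.2, hτ.2]

/-- Moving the centre of the weight `e^{−γ|·−z|/L}` by at most `KL` costs the factor `e^{γK}` (`γ ≥ 0`, `L > 0`).
[cite: Federbush1986PhaseCellI, §4 p. 328 («immediate»)] -/
theorem exp_weight_le {γ L K : ℝ} (hγ : 0 ≤ γ) (hL : 0 < L) {x y z : E4} (hxy : dist y x ≤ K * L) :
    Real.exp (-γ * dist y z / L) ≤ Real.exp (γ * K) * Real.exp (-γ * dist x z / L) := by
  rw [← Real.exp_add]
  apply Real.exp_le_exp.2
  have h1 : dist x z ≤ K * L + dist y z :=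
    (dist_triangle x y z).trans (by rw [dist_comm] at hxy; linarith)
  rw [neg_mul, neg_mul, neg_div, neg_div]
  have h2 : γ * dist x z / L ≤ γ * (K * L + dist y z) / L :=
    div_le_div_of_nonneg_right (mul_le_mul_of_nonneg_left h1 hγ) hL.le
  have h3 : γ * (K * L + dist y z) / L = γ * K + γ * dist y z / L := by
    field_simp
  linarith

/-- Translating the corner translates the integrand of the plaquette average (1.14). [cite: Federbush1986PhaseCellI,
(1.13)–(1.14) p. 324] -/
theorem plaqAvg_comp_add (h : E4 → ℝ) (x v : E4) (μ ν : Fin 4) (ℓ : ℝ) :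
    plaqAvg (fun y => h (y + v)) x μ ν ℓ = plaqAvg h (x + v) μ ν ℓ := by
  unfold plaqAvg
  have e : ∀ (u : Fin 4 → ℝ) (σ τ : ℝ),
      x + ℓ • mkPt u + σ • unitVec μ + τ • unitVec ν + v = x + v + ℓ • mkPt u + σ • unitVec μ + τ • unitVec ν :=
    fun u σ τ => by abel
  simp_rw [e]

/-- The plaquette value is a difference of two differences of ADJACENT PARALLEL bond values:
`A_{∂p} = [A(b,i) − A(b+1_j,i)] − [A(b,j) − A(b+1_i,j)]`. [cite: Federbush1986PhaseCellI, §0 p. 319–320, Fig. 4 p. 324] -/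
theorem plaqOfBonds_eq_sub_sub {r : ℕ} (a : Edge r → ℝ) (p : Plaq r) :
    plaqOfBonds a p = (a ⟨p.base, p.dir₁⟩ - a ⟨p.base + Pi.single p.dir₂ 1, p.dir₁⟩)
      - (a ⟨p.base, p.dir₂⟩ - a ⟨p.base + Pi.single p.dir₁ 1, p.dir₂⟩) := by
  unfold plaqOfBonds; ring

end AbelianAveraging

end Literature.MathematicalPhysics.QuantumFieldTheory.Federbush1986
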